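import Summits.NavierStokesRegularity.NavierStokesRegularity.Theorems.SwirlFreeBudget
import Literature.Analysis.FluidPDE.NSLerayHopfSereginMild
import HarnessLib

/-!
# SwirlFreeBudget, brick for crux K-18.2 (T-18.5): the full CKN gauge AT AN AXIS POINT and the
# scales used by the smooth-case core (seat nsreg-p4)

Support file for the DORMANT route `SwirlThreshold` (crux stmt-NavierStokesRegularity-2002) and
planner nsreg-p2's ROUND-18 assembly `EtaMoserBound → SwirlFreePolynomialBound`.  The frame of
`SwirlFreePolynomialBound` is `FullGauge M u p` (all points of `Q(1/2)`, all scales `≤ 1/4`) and an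
axis point `z₀ ∈ Q(1/8)`; the smooth-case core (`smooth_velocity_bound_of_gauges`, part
`…SmoothGauged`) consumes `A(R/2), C(R), D(R) ≤ M` at `z₀` for ONE `R ≤ 1/4`.  This file records the
bookkeeping: `Q(1/8) ⊆ Q(1/2)` and the three gauge bounds at every admissible scale
(`FullGauge.gauges_at`, `FullGauge.gauges_at_half`), and the inclusion `Q(z₀, 1/4) ⊆ Q(0, 1/2)` for
`z₀ ∈ Q(1/8)` (`parabolicCylinder_quarter_subset_half`) placing the smooth-case cylinder inside the
region where the solution lives.
WHAT THIS IS NOT: not NS regularity — set/gauge bookkeeping; no crux claim.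
-/

namespace Summit.NavierStokesRegularity.NavierStokesRegularity.Theorems.SwirlFreeBudget

open Set Metric
open scoped ENNReal
open Literature.Analysis Literature.Analysis.FluidPDE

noncomputable section

/-- `Q(1/8) ⊆ Q(1/2)` (about the origin). -/
theorem parabolicCylinder_eighth_subset_half :
    parabolicCylinder (1 / 8) (0 : ℝ × EuclideanSpace ℝ (Fin 3)) ⊆ parabolicCylinder (1 / 2) 0 :=
  parabolicCylinder_subset_of_le (by norm_num) (by norm_num) _

/-- **The gauges at an axis point**: under `FullGauge M u p`, at every `z₀ ∈ Q(1/8)` and every scale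
`0 < R ≤ 1/4`: `A(R), C(R), D(R) ≤ M`. -/
theorem FullGauge.gauges_at {M : ℝ} {u : ℝ → EuclideanSpace ℝ (Fin 3) → EuclideanSpace ℝ (Fin 3)}
    {p : ℝ → EuclideanSpace ℝ (Fin 3) → ℝ} (h : FullGauge M u p)
    {z₀ : ℝ × EuclideanSpace ℝ (Fin 3)} (hz₀ : z₀ ∈ parabolicCylinder (1 / 8) (0 : ℝ × EuclideanSpace ℝ (Fin 3)))
    {R : ℝ} (hR : 0 < R) (hR4 : R ≤ 1 / 4) :
    cknA R z₀ u ≤ ENNReal.ofReal M ∧ cknC R z₀ u ≤ ENNReal.ofReal M ∧ cknD R z₀ p ≤ ENNReal.ofReal M :=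
  h z₀ (parabolicCylinder_eighth_subset_half hz₀) R hR hR4

/-- The form consumed by `smooth_velocity_bound_of_gauges`: `A(R/2), C(R), D(R) ≤ M` at `z₀`. -/
theorem FullGauge.gauges_at_half {M : ℝ} {u : ℝ → EuclideanSpace ℝ (Fin 3) → EuclideanSpace ℝ (Fin 3)}
    {p : ℝ → EuclideanSpace ℝ (Fin 3) → ℝ} (h : FullGauge M u p)
    {z₀ : ℝ × EuclideanSpace ℝ (Fin 3)} (hz₀ : z₀ ∈ parabolicCylinder (1 / 8) (0 : ℝ × EuclideanSpace ℝ (Fin 3)))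
    {R : ℝ} (hR : 0 < R) (hR4 : R ≤ 1 / 4) :
    cknA (R / 2) z₀ u ≤ ENNReal.ofReal M ∧ cknC R z₀ u ≤ ENNReal.ofReal M ∧
      cknD R z₀ p ≤ ENNReal.ofReal M :=
  ⟨(h.gauges_at hz₀ (by positivity) (by linarith)).1, (h.gauges_at hz₀ hR hR4).2.1,
    (h.gauges_at hz₀ hR hR4).2.2⟩

/-- For `z₀ ∈ Q(1/8)` the cylinder `Q(z₀, 1/4)` lies inside `Q(0, 1/2)` — so a solution given on
`Q(1/2)` (in particular on `Q₁`) restricts to the axis-centred cylinders of the smooth-case core. -/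
theorem parabolicCylinder_quarter_subset_half {z₀ : ℝ × EuclideanSpace ℝ (Fin 3)}
    (hz₀ : z₀ ∈ parabolicCylinder (1 / 8) (0 : ℝ × EuclideanSpace ℝ (Fin 3))) :
    parabolicCylinder (1 / 4) z₀ ⊆ parabolicCylinder (1 / 2) (0 : ℝ × EuclideanSpace ℝ (Fin 3)) := by
  intro w hw
  rw [mem_parabolicCylinder] at hz₀ hw ⊢
  obtain ⟨⟨h01, h02⟩, hx0⟩ := hz₀
  obtain ⟨⟨hw1, hw2⟩, hwx⟩ := hw
  refine ⟨⟨by norm_num at h01 hw1 ⊢; linarith, by simpa using lt_of_lt_of_le hw2 (le_of_lt (by simpa using h02))⟩, ?_⟩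
  calc dist w.2 (0 : ℝ × EuclideanSpace ℝ (Fin 3)).2 ≤ dist w.2 z₀.2 + dist z₀.2 (0 : ℝ × EuclideanSpace ℝ (Fin 3)).2 :=
        dist_triangle _ _ _
    _ < 1 / 4 + 1 / 8 := by gcongr
    _ ≤ 1 / 2 := by norm_num

end

end Summit.NavierStokesRegularity.NavierStokesRegularity.Theorems.SwirlFreeBudget
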